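import Mathlib
import Summits.Parity.BatemanHorn.Theorems.IsogenyRedeiTypeIMainTermHyperbola

/-!
# Polynomial Möbius tail (stmt-Parity-0870), line Sketch: stub `stub_conv_rate`

A quantitative form of `tendsto_sum_mul_of_summable` (convolution with an absolutely
log-summable factor). If `∑_{n ≤ N} |e(n)| (1 + log n)^B ≤ E` for all `N`, the partial sums of
`F` satisfy `|𝔉(N)| ≤ K/(1 + log N)^A` and `∑_{n ≤ N} |F(n)| ≤ M (1 + log N)^a` (`N ≥ 1`), then
`|∑_{n ≤ N} (e ⋆ F)(n)| ≤ 4^A E K/(1 + log N)^A + 4^B E M (1 + log N)^a/(1 + log N)^B`.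
Proof: `∑_{n ≤ N} (e ⋆ F)(n) = ∑_{m ≤ N} e(m) 𝔉(N/m)`; split at `m ≤ z = ⌊√N⌋`; for `m ≤ z`
the argument `N/m ≥ z` and `1 + log N ≤ 4 (1 + log z)`; for `m > z` the weight
`(1 + log m)^B ≥ (1 + log N)^B/4^B`. Everything here is proved. [folklore]
-/

open scoped BigOperators
open Filter Finset Polynomial Asymptotics

namespace Summit.Parity.BatemanHorn.Theorems.PolyMobiusTail.NaturalForm

open Summit.Parity.BatemanHorn.Theorems.TypeIMainTerm

/-- **Stub `stub_conv_rate`.** Log-rate for a Dirichlet convolution `e ⋆ F` with `e` absolutely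
log-summable: if `∑_{n ≤ N} |e(n)| (1 + log n)^B ≤ E`, `|∑_{n ≤ N} F(n)| ≤ K/(1 + log N)^A` and
`∑_{n ≤ N} |F(n)| ≤ M (1 + log N)^a` for `N ≥ 1`, then for `N ≥ 1`
`|∑_{n ≤ N} (e ⋆ F)(n)| ≤ 4^A E K/(1 + log N)^A + 4^B E M (1 + log N)^a/(1 + log N)^B`
(split `∑_{m ≤ N} e(m) 𝔉(N/m)` at `m ≤ ⌊√N⌋`). [folklore] -/
theorem stub_conv_rate : ∀ (e F : ArithmeticFunction ℝ) (E K M : ℝ) (A B a : ℕ),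
    0 ≤ E → 0 ≤ K → 0 ≤ M →
    (∀ N : ℕ, ∑ n ∈ Finset.Ioc 0 N, |e n| * (1 + Real.log n) ^ B ≤ E) →
    (∀ N : ℕ, 1 ≤ N → |∑ n ∈ Finset.Ioc 0 N, F n| ≤ K / (1 + Real.log N) ^ A) →
    (∀ N : ℕ, 1 ≤ N → ∑ n ∈ Finset.Ioc 0 N, |F n| ≤ M * (1 + Real.log N) ^ a) →
    ∀ N : ℕ, 1 ≤ N → |∑ n ∈ Finset.Ioc 0 N, (e * F) n| ≤
      (4 : ℝ) ^ A * E * K / (1 + Real.log N) ^ A +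
        (4 : ℝ) ^ B * E * M * (1 + Real.log N) ^ a / (1 + Real.log N) ^ B := by
  intro e F E K M A B a _hE hK hM he hF hV N hN
  obtain ⟨hz1, hzN, hzz, hlog4⟩ := sqrt_facts hN
  set z := Nat.sqrt N with hz
  set ℓ : ℝ := 1 + Real.log N with hℓ
  set ℓz : ℝ := 1 + Real.log z with hℓz
  have hℓ1 : 1 ≤ ℓ := one_le_one_add_log hN
  have hℓz1 : 1 ≤ ℓz := one_le_one_add_log hz1
  -- partial sums of `F` and the decomposition `∑ (e ⋆ F) = ∑_{m ≤ N} e(m) 𝔉(N/m)`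
  set S : ℕ → ℝ := fun t => ∑ n ∈ Ioc 0 t, F n with hSdef
  have hdec : ∑ n ∈ Ioc 0 N, (e * F) n = ∑ m ∈ Ioc 0 N, e m * S (N / m) :=
    ArithmeticFunction.sum_Ioc_mul_eq_sum_sum e F N
  -- the weight `(1 + log m)^B ≥ 1`
  have hw1 : ∀ m : ℕ, 1 ≤ m → 1 ≤ (1 + Real.log m) ^ B :=
    fun m hm => one_le_pow₀ (one_le_one_add_log hm)
  -- the two constants
  set C₁ : ℝ := (4 : ℝ) ^ A * K / ℓ ^ A with hC₁
  set C₂ : ℝ := (4 : ℝ) ^ B * M * ℓ ^ a / ℓ ^ B with hC₂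
  have hC₁0 : 0 ≤ C₁ := by rw [hC₁]; positivity
  have hC₂0 : 0 ≤ C₂ := by rw [hC₂]; positivity
  -- (i) small `m ≤ z`: `N/m ≥ z`, so `|𝔉(N/m)| ≤ K/(1 + log z)^A ≤ 4^A K/(1 + log N)^A`
  have hsmall : ∀ m ∈ Ioc 0 z, |e m * S (N / m)| ≤ |e m| * (1 + Real.log m) ^ B * C₁ := by
    intro m hm
    obtain ⟨hm0, hmz⟩ := Finset.mem_Ioc.mp hm
    rw [abs_mul]
    refine mul_le_mul (le_mul_of_one_le_right (abs_nonneg _) (hw1 m hm0)) ?_ (abs_nonneg _)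
      (mul_nonneg (abs_nonneg _) (zero_le_one.trans (hw1 m hm0)))
    have hzm : z ≤ N / m := hzz.trans (Nat.div_le_div_left hmz hm0)
    have h1m : 1 ≤ N / m := hz1.trans hzm
    have h1 : |S (N / m)| ≤ K / ℓz ^ A :=
      (hF (N / m) h1m).trans (div_one_add_log_pow_le hK A hz1 hzm)
    refine h1.trans ?_
    rw [hC₁, div_le_div_iff₀ (by positivity) (by positivity)]
    have hℓA : ℓ ^ A ≤ (4 : ℝ) ^ A * ℓz ^ A := by
      rw [← mul_pow]; exact pow_le_pow_left₀ (by linarith) hlog4 A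
    calc K * ℓ ^ A ≤ K * ((4 : ℝ) ^ A * ℓz ^ A) := mul_le_mul_of_nonneg_left hℓA hK
      _ = (4 : ℝ) ^ A * K * ℓz ^ A := by ring
  -- (ii) large `z < m ≤ N`: `|𝔉(N/m)| ≤ M (1 + log N)^a` and `(1 + log m)^B ≥ (1 + log N)^B/4^B`
  have hlarge : ∀ m ∈ Ioc z N, |e m * S (N / m)| ≤ |e m| * (1 + Real.log m) ^ B * C₂ := by
    intro m hm
    obtain ⟨hzm, -⟩ := Finset.mem_Ioc.mp hm
    rw [abs_mul, mul_assoc]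
    refine mul_le_mul_of_nonneg_left ?_ (abs_nonneg _)
    have hS : |S (N / m)| ≤ M * ℓ ^ a := by
      calc |S (N / m)| ≤ ∑ n ∈ Ioc 0 (N / m), |F n| := Finset.abs_sum_le_sum_abs _ _
        _ ≤ ∑ n ∈ Ioc 0 N, |F n| :=
            Finset.sum_le_sum_of_subset_of_nonneg
              (Finset.Ioc_subset_Ioc_right (Nat.div_le_self N m)) fun _ _ _ => abs_nonneg _
        _ ≤ M * ℓ ^ a := hV N hN
    refine hS.trans ?_
    have hwm : ℓ ≤ 4 * (1 + Real.log m) := by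
      have : Real.log z ≤ Real.log m :=
        Real.log_le_log (by exact_mod_cast hz1) (by exact_mod_cast hzm.le)
      linarith
    have hℓB : ℓ ^ B ≤ (4 : ℝ) ^ B * (1 + Real.log m) ^ B := by
      rw [← mul_pow]; exact pow_le_pow_left₀ (by linarith) hwm B
    rw [hC₂, mul_div_assoc', le_div_iff₀ (by positivity)]
    calc M * ℓ ^ a * ℓ ^ B ≤ M * ℓ ^ a * ((4 : ℝ) ^ B * (1 + Real.log m) ^ B) :=
          mul_le_mul_of_nonneg_left hℓB (by positivity)
      _ = (1 + Real.log m) ^ B * ((4 : ℝ) ^ B * M * ℓ ^ a) := by ring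
  -- the weighted sums of `|e|` over the two ranges are `≤ E`
  have hEz : ∑ m ∈ Ioc 0 z, |e m| * (1 + Real.log m) ^ B ≤ E := he z
  have hEN : ∑ m ∈ Ioc z N, |e m| * (1 + Real.log m) ^ B ≤ E := by
    refine le_trans (Finset.sum_le_sum_of_subset_of_nonneg
      (Finset.Ioc_subset_Ioc_left (Nat.zero_le z)) ?_) (he N)
    intro m hm _
    obtain ⟨hm0, -⟩ := Finset.mem_Ioc.mp hm
    exact mul_nonneg (abs_nonneg _) (zero_le_one.trans (hw1 m hm0))
  rw [hdec]
  calc |∑ m ∈ Ioc 0 N, e m * S (N / m)|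
      ≤ ∑ m ∈ Ioc 0 N, |e m * S (N / m)| := Finset.abs_sum_le_sum_abs _ _
    _ = ∑ m ∈ Ioc 0 z, |e m * S (N / m)| + ∑ m ∈ Ioc z N, |e m * S (N / m)| :=
        (Finset.sum_Ioc_consecutive _ (Nat.zero_le z) hzN).symm
    _ ≤ ∑ m ∈ Ioc 0 z, |e m| * (1 + Real.log m) ^ B * C₁ +
          ∑ m ∈ Ioc z N, |e m| * (1 + Real.log m) ^ B * C₂ :=
        add_le_add (Finset.sum_le_sum hsmall) (Finset.sum_le_sum hlarge)
    _ = (∑ m ∈ Ioc 0 z, |e m| * (1 + Real.log m) ^ B) * C₁ +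
          (∑ m ∈ Ioc z N, |e m| * (1 + Real.log m) ^ B) * C₂ := by
        rw [Finset.sum_mul, Finset.sum_mul]
    _ ≤ E * C₁ + E * C₂ :=
        add_le_add (mul_le_mul_of_nonneg_right hEz hC₁0) (mul_le_mul_of_nonneg_right hEN hC₂0)
    _ = (4 : ℝ) ^ A * E * K / ℓ ^ A + (4 : ℝ) ^ B * E * M * ℓ ^ a / ℓ ^ B := by
        rw [hC₁, hC₂]; ring

end Summit.Parity.BatemanHorn.Theorems.PolyMobiusTail.NaturalForm
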